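import Literature.Combinatorics.Enumerative.AperySupercongruences
import HarnessLib

/-!
# Multivariate Apéry numbers, their prime-power supercongruences (Straub 2014), and Beukers' block-induction lemma

Topic `Literature/Combinatorics/Enumerative` (joins the story of `AperyNumbers`, `AperyNumbersZetaTwo`,
`AperyLucasCongruences`, `AperySupercongruences`). Typed, cited statements read on the page (this session) from
A. Straub, *Multivariate Apéry numbers and supercongruences of rational functions*, Algebra & Number Theory **8**
(2014) 1985–2008 = arXiv:1401.0854 [Straub2014] (held text `paper:arxiv-1401.0854`; equation numbers are the global
ones of the arXiv version, consistent with the `(25)` already cited in `AperySupercongruences`), with the two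
classical prime-power supercongruences it starts from: (2) `A(p^r m) ≡ A(p^{r−1} m) (mod p^{3r})` (Coster 1988
[Coster1988]; `r = 1`: Gessel 1982, in the tree) and (3) `A(p^r m − 1) ≡ A(p^{r−1} m − 1) (mod p^{3r})` (Beukers 1985
[Beukers1985]) — exactly the items listed under "Not covered" in `AperySupercongruences`.

## What is printed (verbatim, [Straub2014])

* §1, (1)–(3): "The Apéry numbers `A(n) = Σ_{k=0}^{n} C(n,k)² C(n+k,k)²` … satisfy … for all primes `p ≥ 5` and all
  positive integers `r`, (2) `A(p^r m) ≡ A(p^{r−1} m) (mod p^{3r})`. … The case `r = 1` was subsequently shown by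
  I. Gessel and Y. Mimura, while the general case has been proved by M. Coster. The proof is an adaption of
  F. Beukers' proof of the related congruence (3) `A(p^r m − 1) ≡ A(p^{r−1} m − 1) (mod p^{3r})`, again valid for all
  primes `p ≥ 5` and all positive integers `r`."
* **Theorem 1.1.** "The Apéry numbers `A(n)` are the diagonal coefficients of (6)
  `1/((1 − x₁ − x₂)(1 − x₃ − x₄) − x₁x₂x₃x₄)`."  With (7) `F(x₁,x₂,x₃,x₄) = Σ_{𝐧 ≥ 0} A(n₁,n₂,n₃,n₄) 𝐱^𝐧` one has
  "the explicit formula (8) `A(𝐧) = Σ_{k ∈ ℤ} C(n₁,k) C(n₃,k) C(n₁+n₂−k, n₁) C(n₃+n₄−k, n₃)`, of which Theorem 1.1 is an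
  immediate consequence."
* **Theorem 1.2.** "Let `𝐧 = (n₁,n₂,n₃,n₄) ∈ ℤ⁴`. The coefficients `A(𝐧)`, defined in (7) and extended to negative
  integers by (8), satisfy, for primes `p ≥ 5` and positive integers `r`, the supercongruences
  (9) `A(p^r 𝐧) ≡ A(p^{r−1} 𝐧) (mod p^{3r})`."  (p. 4: "the Apéry numbers are `A(n) = A(n,n,n,n)` so that (9) indeed
  generalizes (2)"; negative entries recover Beukers' (3) via `A(n − 1) = A(−n,−n,−n,−n)`, Remark 1.3.)
* §3, **Theorem 3.1** ((19)–(20): the coefficients `A_{λ,α}(𝐧)` of `(∏_j [1 − Σ_{r ≤ λ_j} x_{s(j)+r}] − α x₁⋯x_d)^{−1}`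
  as a single sum of products of multinomial coefficients) and **Theorem 3.2** ("Let `ε ∈ {−1,1}`, `λ ∈ ℤ_{>0}^ℓ` …
  If `ℓ ≥ 2`, then, for all primes `p ≥ 3` and integers `r ≥ 1`, (21) `A_{λ,ε}(p^r 𝐧) ≡ A_{λ,ε}(p^{r−1} 𝐧) (mod p^{2r})`.
  If `ε = 1`, then these congruences also hold for `p = 2`.  If `ℓ ≥ 2` and `max(λ₁,…,λ_ℓ) ≤ 2`, then, for primes
  `p ≥ 5` and integers `r ≥ 1`, (22) `A_{λ,ε}(p^r 𝐧) ≡ A_{λ,ε}(p^{r−1} 𝐧) (mod p^{3r})`.")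
* **Example 3.4** (`λ = (2,1)`, `ε = 1`): Apéry's `ζ(2)` numbers (23) `B(n) = Σ_k C(n,k)² C(n+k,k)` "are the diagonal
  coefficients of the rational function (24) `1/((1 − x₁ − x₂)(1 − x₃) − x₁x₂x₃) = Σ_{𝐧 ∈ ℤ³_{≥0}} B(𝐧) 𝐱^𝐧`" and
  "for `𝐧 ∈ ℤ³` and integers `r ≥ 1`, the supercongruences (25) `B(p^r 𝐧) ≡ B(p^{r−1} 𝐧) (mod p^{3r})` hold for all
  primes `p ≥ 5`. In the diagonal case `n₁ = n₂ = n₃`, this result was first proved by Coster."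
* §5, **Lemma 5.2**: "Let `p ≥ 5` be a prime, and `ε ∈ {−1, 1}`. Then, for all integers `r ≥ 0`,
  (36) `Σ_{k=1, p∤k}^{p^r−1} ε^k/k² ≡ 0 (mod p^r)`."  (Printed proof: rescale `k ↦ αk` with `α` odd, `p ∤ α`,
  `α² ≢ 1 (mod p)`, "since the second and third sum run over the same residues modulo `p^r` (note that
  `ε^{αk} = ε^k` since `α` is odd)".)
* §5, **Lemma 5.4**: "For primes `p`, integers `m, k` and integers `r ≥ 1`,
  `C(p^r m − 1, k) (−1)^k ≡ C(p^{r−1} m − 1, [k/p]) (−1)^{[k/p]} (mod p^r)`."  Proof (case `k ≥ 0`): "Following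
  [Beukers 1985], we split the defining product of the binomial coefficient, according to whether the index is divisible
  by `p` or not, to obtain `C(p^r m − 1, k) = ∏_{j=1}^{k} (p^r m − j)/j = C(p^{r−1} m − 1, [k/p]) ∏_{j=1, p∤j}^{k} (p^r m − j)/j`.
  Congruence (43) with `k ≥ 0` follows upon reducing modulo `p^r`."
* §5, **Lemma 5.6** (the block induction; "The following generalizes [Beukers 1985] to our needs."): "Let `p` be a
  prime and `𝐧 ∈ ℤ^d`. • Let `a_k ∈ ℤ_p`, with `k ∈ ℤ`, be such that, for all `l, s ∈ ℤ` with `s ≥ 0`,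
  `Σ_{[k/p^s] = l} a_k ≡ 0 (mod p^s)`. • Let `C(𝐧; k)` be such that, for all `k, r ∈ ℤ` with `r ≥ 0`,
  `C(p^r 𝐧; k) ≡ C(p^{r−1} 𝐧; [k/p]) (mod p^r)`. Then, for all `r, l ∈ ℤ` with `r ≥ 0`,
  `Σ_{[k/p^r] = l} a_k C(p^r 𝐧; k) ≡ 0 (mod p^r)`."  (Proof by induction on `r` with `b_m = p^{−1} Σ_{[k/p]=m} a_k`.)

## What is typed / proved

* `straubA n₁ n₂ n₃ n₄ : ℕ` IS the printed binomial sum (8) for `𝐧 ∈ ℤ_{≥0}^4` (there the sum runs over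
  `0 ≤ k ≤ min nᵢ`; we sum over `k ≤ n₁`, the extra terms vanishing); PROVED `straubA_diag : A(n,n,n,n) = A(n)`
  (the tree's `AperyNumbers.aperyNumber`), kernel checks of small values.  `straubB n₁ n₂ n₃` is (20) for
  `λ = (2,1)`, `ε = 1` (the trinomial coefficient `(n₁+n₂−k; n₁−k, n₂−k, k)` written as `C(n₁,k)·C(n₁+n₂−k,n₁)`);
  PROVED `straubB_diag : B(n,n,n) = B(n)` (the tree's `AperyNumbersZetaTwo.apery2Number`).
* NAMED FACTS (no proofs; D-0014): `theorem11` (Theorem 1.1 with (7)–(8), as the identity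
  `((1−x₁−x₂)(1−x₃−x₄) − x₁x₂x₃x₄) · Σ A(𝐧)𝐱^𝐧 = 1` in `MvPowerSeries (Fin 4) ℤ`), `example34_genFun` ((24), same
  form in three variables), `theorem12` ((9) for `𝐧 ∈ ℤ_{≥0}^4`), `example34_supercongruence` ((25) for
  `𝐧 ∈ ℤ_{≥0}^3`), `coster1988_supercongruence` ((2)), `beukers1985_supercongruence` ((3)).
  TODO(general form): Theorems 1.2 / 3.2 for `𝐧 ∈ ℤ^d` with Straub's Gamma-limit binomials (11) (which is what
  makes (3) a case of (9)), and Theorems 3.1–3.2 for a general partition `λ`; only `λ = (2,2), (2,1)` are typed.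
* PROVED reductions: `coster1988_of_theorem12` ((9) on the diagonal is (2)), `coster1988_r_one` (the case `r = 1`
  of (2), unconditionally, = the tree's Gessel theorem), `example34_r_one_diag` (the case `r = 1` of (25) on the
  diagonal, = the tree's Coster `ζ(2)` companion).
* PROVED **Lemma 5.6** in the abstract form `sum_block_dvd` over any commutative ring in which `p` is not a zero
  divisor (`ℤ`, `ℤ_p`, `ℤ_{(p)}` …): blocks `{k : [k/p^s] = l} = [l p^s, (l+1) p^s)` (`block`, `mem_block_iff`), the
  regrouping `Σ_{[k/p^{s+1}] = l} = Σ_{[m/p^s] = l} Σ_{[k/p] = m}` (`sum_block_succ`), and the induction on `r`.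
* PROVED **Lemma 5.2** for every `r ≥ 0` and both signs (`lemma52`, read in `ZMod (p^r)` with `k⁻¹` the inverse
  of the unit `k`): for `ε = 1` by the printed rescaling (with `α = 2`: `Σ_x G(2x) = Σ_x G(x)` over `ZMod (p^r)`,
  `sum_units_inv_sq_eq_zero`, `sum_range_inv_sq_eq_zero`); for `ε = −1` the summand `ε^k/k²` is NOT a function of
  `k mod p^r` (`p^r` is odd), so the printed rescaling does not apply verbatim — we use instead the reflection
  `k ↦ p^r − k` (the full sum is twice the half sum) and the doubling `k ↦ 2k` (the even-indexed sum is `2⁻²` times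
  the half sum), `sum_range_neg_one_pow_mul_inv_sq_eq_zero`.
* PROVED **Lemma 5.4** (Beukers' digit reduction `C(p^r m − 1, k)(−1)^k ≡ C(p^{r−1} m − 1, [k/p])(−1)^{[k/p]} (mod p^r)`)
  for `k ≥ 0`, `m ≥ 1` (`lemma54`; the printed first case, by the printed splitting of the defining product of the
  binomial coefficient according to `p ∣ j` or not: `factorial_split`, `descFactorial_split`, `choose_mul_prod_eq`,
  then inverting `∏_{p∤j≤k} j` modulo `p^r` in `lemma54_core`).  TODO(general form): `k < 0` or `m ≤ 0` with (11).

Transcription checks (this session, outside Lean): (8) against the Taylor expansion of (6) on the box `𝐧 ≤ 5`,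
(20)_{λ=(2,1)} against (24) on `𝐧 ≤ 6`; (9) and (25) for `p ∈ {5,7}`, `r ∈ {1,2}` on random `𝐧 ≤ 3` (no violation),
and `p = 3` violates the modulus `p³` but not `p²` (as (21) predicts).
-/

open Finset

namespace Literature.Combinatorics.Enumerative.MultivariateAperyNumbers

/-! ### The multivariate Apéry numbers `A(n₁,n₂,n₃,n₄)` and `B(n₁,n₂,n₃)` -/

/-- Straub's multivariate Apéry numbers for `𝐧 ∈ ℤ_{≥0}^4`:
`A(n₁,n₂,n₃,n₄) = Σ_k C(n₁,k) C(n₃,k) C(n₁+n₂−k, n₁) C(n₃+n₄−k, n₃)` (the sum over `k ≤ n₁` equals the printed sum over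
`0 ≤ k ≤ min nᵢ`: terms with `k > min nᵢ` vanish). [cite: Straub2014, (8)] -/
def straubA (n₁ n₂ n₃ n₄ : ℕ) : ℕ :=
  ∑ k ∈ range (n₁ + 1), n₁.choose k * n₃.choose k * (n₁ + n₂ - k).choose n₁ * (n₃ + n₄ - k).choose n₃

/-- Kernel check of small values of (8) (computed this session from the Taylor expansion of (6)):
`A(1,1,1,1) = 5`, `A(2,2,2,2) = 73`, `A(1,0,0,0) = 1`, `A(1,1,0,0) = 2`, `A(2,1,1,1) = 8`, `A(3,1,2,2) = 42`,
`A(1,2,3,4) = 225`. [cite: Straub2014, (6)–(8)] -/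
theorem straubA_values :
    [straubA 1 1 1 1, straubA 2 2 2 2, straubA 1 0 0 0, straubA 1 1 0 0, straubA 2 1 1 1, straubA 3 1 2 2,
      straubA 1 2 3 4] = [5, 73, 1, 2, 8, 42, 225] := by
  decide

/-- "The Apéry numbers are `A(n) = A(n,n,n,n)`" (reindex `k ↦ n − k` in (8)). [cite: Straub2014, §1 (p. 4, after (9))] -/
theorem straubA_diag (n : ℕ) : straubA n n n n = AperyNumbers.aperyNumber n := by
  unfold straubA AperyNumbers.aperyNumber AperyNumbers.aperyTerm
  rw [← Finset.sum_range_reflect]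
  apply Finset.sum_congr rfl
  intro k hk
  rw [Finset.mem_range] at hk
  have hk' : k ≤ n := by omega
  have h1 : n + 1 - 1 - k = n - k := by omega
  have h2 : n + n - (n - k) = n + k := by omega
  rw [h1, Nat.choose_symm hk', h2, Nat.choose_symm_add]
  ring

/-- The `λ = (2,1)`, `ε = 1` numbers of Theorem 3.1 for `𝐧 ∈ ℤ_{≥0}^3`:
`B(n₁,n₂,n₃) = Σ_k (n₁+n₂−k; n₁−k, n₂−k, k) · C(n₃,k) = Σ_k C(n₁,k) C(n₁+n₂−k, n₁) C(n₃, k)`.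
[cite: Straub2014, (20) (λ = (2,1)), Example 3.4] -/
def straubB (n₁ n₂ n₃ : ℕ) : ℕ :=
  ∑ k ∈ range (n₁ + 1), n₁.choose k * (n₁ + n₂ - k).choose n₁ * n₃.choose k

/-- Kernel check of small values (computed this session from the Taylor expansion of (24)): `B(1,1,1) = 3`,
`B(2,2,2) = 19`, `B(1,0,0) = 1`, `B(2,1,1) = 5`, `B(1,2,3) = 9`, `B(3,2,2) = 37`. [cite: Straub2014, (24)] -/
theorem straubB_values :
    [straubB 1 1 1, straubB 2 2 2, straubB 1 0 0, straubB 2 1 1, straubB 1 2 3, straubB 3 2 2] =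
      [3, 19, 1, 5, 9, 37] := by
  decide

/-- On the diagonal `B(n,n,n)` is Apéry's `ζ(2)` number `B(n) = Σ_k C(n,k)² C(n+k,k)` (23).
[cite: Straub2014, Example 3.4 ((23)–(24))] -/
theorem straubB_diag (n : ℕ) : straubB n n n = AperyNumbersZetaTwo.apery2Number n := by
  unfold straubB AperyNumbersZetaTwo.apery2Number AperyNumbersZetaTwo.apery2Term
  rw [← Finset.sum_range_reflect]
  apply Finset.sum_congr rfl
  intro k hk
  rw [Finset.mem_range] at hk
  have hk' : k ≤ n := by omega
  have h1 : n + 1 - 1 - k = n - k := by omega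
  have h2 : n + n - (n - k) = n + k := by omega
  rw [h1, Nat.choose_symm hk', h2, Nat.choose_symm_add]
  ring

/-! ### The rational generating functions (Theorem 1.1, Example 3.4) — named facts -/

/-- The denominator `(1 − x₁ − x₂)(1 − x₃ − x₄) − x₁x₂x₃x₄` of (6), variables indexed by `Fin 4`.
[cite: Straub2014, (6)] -/
noncomputable def straubDenomA : MvPolynomial (Fin 4) ℤ :=
  (1 - MvPolynomial.X 0 - MvPolynomial.X 1) * (1 - MvPolynomial.X 2 - MvPolynomial.X 3) -
    MvPolynomial.X 0 * MvPolynomial.X 1 * MvPolynomial.X 2 * MvPolynomial.X 3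

/-- The generating series `F = Σ_{𝐧 ≥ 0} A(𝐧) 𝐱^𝐧` of (7). [cite: Straub2014, (7)] -/
def straubSeriesA : MvPowerSeries (Fin 4) ℤ := fun m => (straubA (m 0) (m 1) (m 2) (m 3) : ℤ)

/-- **Straub 2014, Theorem 1.1 with (7)–(8)** (named fact): the binomial sums (8) are the Taylor coefficients of
`1/((1 − x₁ − x₂)(1 − x₃ − x₄) − x₁x₂x₃x₄)`, i.e. `((1 − x₁ − x₂)(1 − x₃ − x₄) − x₁x₂x₃x₄) · F = 1` in `ℤ⟦x₁,…,x₄⟧`;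
with `straubA_diag`, the Apéry numbers are the diagonal coefficients of (6).
[cite: Straub2014, Theorem 1.1, (7)–(8)] -/
def theorem11 : Prop :=
  (straubDenomA : MvPowerSeries (Fin 4) ℤ) * straubSeriesA = 1

/-- The denominator `(1 − x₁ − x₂)(1 − x₃) − x₁x₂x₃` of (24), variables indexed by `Fin 3`.
[cite: Straub2014, (24)] -/
noncomputable def straubDenomB : MvPolynomial (Fin 3) ℤ :=
  (1 - MvPolynomial.X 0 - MvPolynomial.X 1) * (1 - MvPolynomial.X 2) -
    MvPolynomial.X 0 * MvPolynomial.X 1 * MvPolynomial.X 2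

/-- The generating series `Σ_{𝐧 ≥ 0} B(𝐧) 𝐱^𝐧` of (24). [cite: Straub2014, (24)] -/
def straubSeriesB : MvPowerSeries (Fin 3) ℤ := fun m => (straubB (m 0) (m 1) (m 2) : ℤ)

/-- **Straub 2014, Example 3.4, (24)** (named fact; Theorem 3.1 for `λ = (2,1)`, `ε = 1`):
`((1 − x₁ − x₂)(1 − x₃) − x₁x₂x₃) · Σ B(𝐧)𝐱^𝐧 = 1` in `ℤ⟦x₁,x₂,x₃⟧`; with `straubB_diag`, Apéry's `ζ(2)` numbers are
the diagonal coefficients of (24). [cite: Straub2014, Example 3.4 (24); Theorem 3.1] -/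
def example34_genFun : Prop :=
  (straubDenomB : MvPowerSeries (Fin 3) ℤ) * straubSeriesB = 1

/-! ### The supercongruences — named facts and proved reductions -/

/-- **Straub 2014, Theorem 1.2** for `𝐧 ∈ ℤ_{≥0}^4` (named fact): for primes `p ≥ 5`, integers `r ≥ 1` and all
`n₁,n₂,n₃,n₄ ≥ 0`, `A(p^r 𝐧) ≡ A(p^{r−1} 𝐧) (mod p^{3r})`.
TODO(general form): `𝐧 ∈ ℤ⁴` with the binomials extended by (11). [cite: Straub2014, Theorem 1.2 (9)] -/
def theorem12 : Prop :=
  ∀ p : ℕ, p.Prime → 5 ≤ p → ∀ r : ℕ, 1 ≤ r → ∀ n₁ n₂ n₃ n₄ : ℕ,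
    (straubA (p ^ r * n₁) (p ^ r * n₂) (p ^ r * n₃) (p ^ r * n₄) : ℤ) ≡
      straubA (p ^ (r - 1) * n₁) (p ^ (r - 1) * n₂) (p ^ (r - 1) * n₃) (p ^ (r - 1) * n₄) [ZMOD (p : ℤ) ^ (3 * r)]

/-- **Straub 2014, (25)** for `𝐧 ∈ ℤ_{≥0}^3` (named fact; Theorem 3.2 (22) for `λ = (2,1)`, `ε = 1`): for primes
`p ≥ 5`, `r ≥ 1`, `B(p^r 𝐧) ≡ B(p^{r−1} 𝐧) (mod p^{3r})`. TODO(general form): `𝐧 ∈ ℤ³`.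
[cite: Straub2014, Example 3.4 (25); Theorem 3.2 (22)] -/
def example34_supercongruence : Prop :=
  ∀ p : ℕ, p.Prime → 5 ≤ p → ∀ r : ℕ, 1 ≤ r → ∀ n₁ n₂ n₃ : ℕ,
    (straubB (p ^ r * n₁) (p ^ r * n₂) (p ^ r * n₃) : ℤ) ≡
      straubB (p ^ (r - 1) * n₁) (p ^ (r - 1) * n₂) (p ^ (r - 1) * n₃) [ZMOD (p : ℤ) ^ (3 * r)]

/-- **The prime-power supercongruence for the Apéry numbers** (Coster 1988; `r = 1` Gessel 1982 / Mimura 1983), as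
printed in [Straub2014] (2) (named fact): for primes `p ≥ 5`, `r ≥ 1` and all `m`,
`A(p^r m) ≡ A(p^{r−1} m) (mod p^{3r})`. [cite: Straub2014, (2)] [cite: Coster1988, (two-term supercongruence)] -/
def coster1988_supercongruence : Prop :=
  ∀ p : ℕ, p.Prime → 5 ≤ p → ∀ r : ℕ, 1 ≤ r → ∀ m : ℕ,
    (AperyNumbers.aperyNumber (p ^ r * m) : ℤ) ≡ AperyNumbers.aperyNumber (p ^ (r - 1) * m)
      [ZMOD (p : ℤ) ^ (3 * r)]

/-- **Beukers 1985, the shifted prime-power supercongruence**, as printed in [Straub2014] (3) (named fact): for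
primes `p ≥ 5`, `r ≥ 1` and positive `m`, `A(p^r m − 1) ≡ A(p^{r−1} m − 1) (mod p^{3r})`.
[cite: Beukers1985, Theorem (as restated in Straub2014 (3))] [cite: Straub2014, (3)] -/
def beukers1985_supercongruence : Prop :=
  ∀ p : ℕ, p.Prime → 5 ≤ p → ∀ r : ℕ, 1 ≤ r → ∀ m : ℕ, 1 ≤ m →
    (AperyNumbers.aperyNumber (p ^ r * m - 1) : ℤ) ≡ AperyNumbers.aperyNumber (p ^ (r - 1) * m - 1)
      [ZMOD (p : ℤ) ^ (3 * r)]

/-- (9) on the diagonal is (2): Theorem 1.2 implies the Coster supercongruence ("(9) indeed generalizes (2)").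
[cite: Straub2014, §1 (p. 4)] -/
theorem coster1988_of_theorem12 (h : theorem12) : coster1988_supercongruence := by
  intro p hp h5 r hr m
  have := h p hp h5 r hr m m m m
  rwa [straubA_diag, straubA_diag] at this

/-- The case `r = 1` of (2), unconditionally: `A(pm) ≡ A(m) (mod p³)` for primes `p ≥ 5` — the tree's Gessel
theorem `AperySupercongruences.aperyNumber_modEq_mul_prime`. [cite: Straub2014, (2) (r = 1: Gessel, Mimura)] -/
theorem coster1988_r_one (p : ℕ) (hp : p.Prime) (h5 : 5 ≤ p) (m : ℕ) :
    (AperyNumbers.aperyNumber (p ^ 1 * m) : ℤ) ≡ AperyNumbers.aperyNumber (p ^ (1 - 1) * m)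
      [ZMOD (p : ℤ) ^ (3 * 1)] := by
  haveI : Fact p.Prime := ⟨hp⟩
  have h := AperySupercongruences.aperyNumber_modEq_mul_prime (p := p) hp (by omega) m
  simpa [mul_comm] using h

/-- The case `r = 1` of (25) on the diagonal, unconditionally: `B(pm) ≡ B(m) (mod p³)` for primes `p ≥ 5` — the
tree's `AperySupercongruences.apery2Number_modEq_mul_prime`. [cite: Straub2014, (25) (diagonal case, r = 1)] -/
theorem example34_r_one_diag (p : ℕ) (hp : p.Prime) (h5 : 5 ≤ p) (m : ℕ) :
    (straubB (p ^ 1 * m) (p ^ 1 * m) (p ^ 1 * m) : ℤ) ≡ straubB (p ^ (1 - 1) * m) (p ^ (1 - 1) * m) (p ^ (1 - 1) * m)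
      [ZMOD (p : ℤ) ^ (3 * 1)] := by
  haveI : Fact p.Prime := ⟨hp⟩
  rw [straubB_diag, straubB_diag]
  have h := AperySupercongruences.apery2Number_modEq_mul_prime (p := p) hp (by omega) m
  simpa [mul_comm] using h

/-! ### Lemma 5.6: the Beukers–Straub block induction (PROVED) -/

section BlockInduction

variable {R : Type*} [CommRing R]

/-- The digit block `{k ∈ ℤ : [k/p^s] = l} = [l·p^s, (l+1)·p^s)`. [cite: Straub2014, Lemma 5.6 (index sets)] -/
noncomputable def block (p : ℕ) (l : ℤ) (s : ℕ) : Finset ℤ :=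
  Finset.Ico (l * (p : ℤ) ^ s) ((l + 1) * (p : ℤ) ^ s)

/-- For `q > 0`: `k / q = l ↔ l q ≤ k < (l+1) q` (floor division). [folklore] -/
private theorem ediv_eq_iff_mem_Ico {q : ℤ} (hq : 0 < q) (k l : ℤ) : k / q = l ↔ l * q ≤ k ∧ k < (l + 1) * q := by
  constructor
  · rintro rfl
    exact ⟨Int.ediv_mul_le k hq.ne', by have := Int.lt_ediv_add_one_mul_self k hq; linarith⟩
  · rintro ⟨h1, h2⟩
    apply le_antisymm
    · have : k / q < l + 1 := by rw [Int.ediv_lt_iff_lt_mul hq]; linarith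
      omega
    · rw [Int.le_ediv_iff_mul_le hq]; linarith

/-- Membership in a block is the digit condition `[k/p^s] = l`. [cite: Straub2014, Lemma 5.6 (index sets)] -/
theorem mem_block_iff {p : ℕ} (hp : 0 < p) {l : ℤ} {s : ℕ} {k : ℤ} :
    k ∈ block p l s ↔ k / (p : ℤ) ^ s = l := by
  rw [block, Finset.mem_Ico, ediv_eq_iff_mem_Ico (by positivity)]

/-- Regrouping a level-`s+1` block by level-`1` sub-blocks:
`Σ_{[k/p^{s+1}] = l} f k = Σ_{[m/p^s] = l} Σ_{[k/p] = m} f k`. [cite: Straub2014, Lemma 5.6 (proof, second line)] -/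
theorem sum_block_succ {M : Type*} [AddCommMonoid M] {p : ℕ} (hp : 0 < p) (f : ℤ → M) (l : ℤ) (s : ℕ) :
    ∑ k ∈ block p l (s + 1), f k = ∑ m ∈ block p l s, ∑ k ∈ block p m 1, f k := by
  have hp' : (0 : ℤ) < p := by exact_mod_cast hp
  have hdiv : ∀ k : ℤ, k / (p : ℤ) / (p : ℤ) ^ s = k / (p : ℤ) ^ (s + 1) := by
    intro k
    rw [Int.ediv_ediv_of_nonneg hp'.le, pow_succ']
  have hmaps : ∀ k ∈ block p l (s + 1), k / (p : ℤ) ∈ block p l s := by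
    intro k hk
    rw [mem_block_iff hp] at hk ⊢
    rw [hdiv, hk]
  rw [← Finset.sum_fiberwise_of_maps_to hmaps]
  apply Finset.sum_congr rfl
  intro m hm
  apply Finset.sum_congr _ (fun _ _ => rfl)
  ext k
  rw [Finset.mem_filter, mem_block_iff hp, mem_block_iff hp, pow_one]
  rw [mem_block_iff hp] at hm
  constructor
  · rintro ⟨_, h⟩; exact h
  · intro h
    refine ⟨?_, h⟩
    rw [← hdiv, h, hm]

/-- **Straub 2014, Lemma 5.6 (Beukers' block induction), PROVED** — abstract form over a commutative ring `R` in
which `p` is not a zero divisor (e.g. `ℤ`, `ℤ_p`, `ℤ_{(p)}`): if `Σ_{[k/p^s] = l} a_k ≡ 0 (mod p^s)` for all `s ≥ 0`,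
`l ∈ ℤ`, and `C_r(k) ≡ C_{r−1}([k/p]) (mod p^r)` for all `r ≥ 1`, `k ∈ ℤ` (here `C_r(k)` stands for the printed
`C(p^r 𝐧; k)`), then `Σ_{[k/p^r] = l} a_k C_r(k) ≡ 0 (mod p^r)` for all `r ≥ 0`, `l ∈ ℤ`.
[cite: Straub2014, Lemma 5.6] -/
theorem sum_block_dvd {p : ℕ} (hp : 0 < p) (hreg : ∀ x : R, (p : R) * x = 0 → x = 0)
    (C : ℕ → ℤ → R) (hC : ∀ r : ℕ, 1 ≤ r → ∀ k : ℤ, (p : R) ^ r ∣ C r k - C (r - 1) (k / p)) :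
    ∀ (r : ℕ) (a : ℤ → R), (∀ (s : ℕ) (l : ℤ), (p : R) ^ s ∣ ∑ k ∈ block p l s, a k) →
      ∀ l : ℤ, (p : R) ^ r ∣ ∑ k ∈ block p l r, a k * C r k := by
  intro r
  induction r with
  | zero => intro a _ l; simp
  | succ r ih =>
    intro a ha l
    -- `b_m = p^{-1} Σ_{[k/p] = m} a_k`
    choose b hb using fun m : ℤ => ha 1 m
    simp only [pow_one] at hb
    -- the new sequence satisfies the same block hypothesis
    have hbhyp : ∀ (s : ℕ) (l : ℤ), (p : R) ^ s ∣ ∑ m ∈ block p l s, b m := by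
      intro s l'
      obtain ⟨c, hc⟩ := ha (s + 1) l'
      rw [sum_block_succ hp, Finset.sum_congr rfl (fun m _ => hb m), ← Finset.mul_sum, pow_succ', mul_assoc] at hc
      refine ⟨c, ?_⟩
      have h0 : (p : R) * (∑ m ∈ block p l' s, b m - (p : R) ^ s * c) = 0 := by
        rw [mul_sub, hc, sub_self]
      have := hreg _ h0
      rwa [sub_eq_zero] at this
    -- termwise replacement `C_{r+1}(k) ≡ C_r([k/p]) (mod p^{r+1})`
    have hterm : (p : R) ^ (r + 1) ∣
        ∑ k ∈ block p l (r + 1), a k * C (r + 1) k - ∑ k ∈ block p l (r + 1), a k * C r (k / p) := by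
      rw [← Finset.sum_sub_distrib]
      apply Finset.dvd_sum
      intro k _
      rw [← mul_sub]
      exact Dvd.dvd.mul_left (by simpa using hC (r + 1) (by omega) k) _
    -- regroup and apply the induction hypothesis to `b`
    have hregroup : ∑ k ∈ block p l (r + 1), a k * C r (k / p) = (p : R) * ∑ m ∈ block p l r, b m * C r m := by
      rw [sum_block_succ hp, Finset.mul_sum]
      apply Finset.sum_congr rfl
      intro m _
      have hfib : ∀ k ∈ block p m 1, a k * C r (k / p) = a k * C r m := by
        intro k hk
        rw [mem_block_iff hp, pow_one] at hk
        rw [hk]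
      rw [Finset.sum_congr rfl hfib, ← Finset.sum_mul, hb m]
      ring
    have hih := ih b hbhyp l
    have h2 : (p : R) ^ (r + 1) ∣ ∑ k ∈ block p l (r + 1), a k * C r (k / p) := by
      rw [hregroup, pow_succ']
      exact mul_dvd_mul_left _ hih
    have := dvd_add hterm h2
    simpa using this

/-- Lemma 5.6 over `ℤ`, in the printed congruence form. [cite: Straub2014, Lemma 5.6] -/
theorem sum_block_modEq_zero_int {p : ℕ} (hp : 0 < p) (a : ℤ → ℤ) (C : ℕ → ℤ → ℤ)
    (ha : ∀ (s : ℕ) (l : ℤ), ∑ k ∈ block p l s, a k ≡ 0 [ZMOD (p : ℤ) ^ s])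
    (hC : ∀ r : ℕ, 1 ≤ r → ∀ k : ℤ, C r k ≡ C (r - 1) (k / p) [ZMOD (p : ℤ) ^ r]) (r : ℕ) (l : ℤ) :
    ∑ k ∈ block p l r, a k * C r k ≡ 0 [ZMOD (p : ℤ) ^ r] := by
  have hp' : (p : ℤ) ≠ 0 := by exact_mod_cast hp.ne'
  refine (Int.modEq_zero_iff_dvd.mpr ?_)
  refine sum_block_dvd (R := ℤ) hp (fun x hx => (mul_eq_zero.mp hx).resolve_left hp') C ?_ r a ?_ l
  · intro r' hr' k
    exact (Int.ModEq.dvd (hC r' hr' k)).elim fun c hc => ⟨-c, by linarith⟩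
  · intro s l'
    exact Int.modEq_zero_iff_dvd.mp (ha s l')

end BlockInduction

/-! ### Lemma 5.4: Beukers' digit reduction for `C(p^r m − 1, k)` (PROVED, case `k ≥ 0`, `m ≥ 1`) -/

section DigitReduction

/-- Splitting `k!` according to `p ∣ j` or not: `k! = (∏_{j ≤ k, p ∤ j} j) · p^{[k/p]} · [k/p]!` (products over
`j = i + 1`, `i < k`). [cite: Straub2014, Lemma 5.4 (proof: "we split the defining product … according to whether the
index is divisible by p or not")] -/
theorem factorial_split (p : ℕ) (hp : 0 < p) : ∀ k : ℕ,
    k.factorial = (∏ i ∈ range k, if p ∣ i + 1 then 1 else (i + 1)) * (p ^ (k / p) * (k / p).factorial)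
  | 0 => by simp [Nat.div_eq_of_lt hp]
  | k + 1 => by
    rw [Nat.factorial_succ, factorial_split p hp k, prod_range_succ]
    by_cases h : p ∣ k + 1
    · rw [if_pos h, Nat.succ_div_of_dvd h, Nat.factorial_succ, pow_succ]
      obtain ⟨c, hc⟩ := h
      have hc' : (k + 1) / p = c := by rw [hc, Nat.mul_div_cancel_left _ hp]
      rw [show k / p + 1 = c by rw [← Nat.succ_div_of_dvd ⟨c, hc⟩]; exact hc']
      rw [hc]; ring
    · rw [if_neg h, Nat.succ_div_of_not_dvd h]; ring

/-- Splitting the falling factorial `(pN' − 1)(pN' − 2)⋯(pN' − k)` the same way: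
`= (∏_{j ≤ k, p ∤ j} (pN' − j)) · p^{[k/p]} · (N' − 1)(N' − 2)⋯(N' − [k/p])`.
[cite: Straub2014, Lemma 5.4 (proof, displayed product)] -/
theorem descFactorial_split (p : ℕ) (hp : 0 < p) (N' : ℕ) : ∀ k : ℕ,
    (p * N' - 1).descFactorial k =
      (∏ i ∈ range k, if p ∣ i + 1 then 1 else (p * N' - (i + 1))) * (p ^ (k / p) * (N' - 1).descFactorial (k / p))
  | 0 => by simp [Nat.div_eq_of_lt hp]
  | k + 1 => by
    rw [Nat.descFactorial_succ, descFactorial_split p hp N' k, prod_range_succ]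
    by_cases h : p ∣ k + 1
    · rw [if_pos h, Nat.succ_div_of_dvd h, Nat.descFactorial_succ, pow_succ]
      obtain ⟨c, hc⟩ := h
      have hc' : k / p + 1 = c := by
        rw [← Nat.succ_div_of_dvd ⟨c, hc⟩, hc, Nat.mul_div_cancel_left _ hp]
      have h1 : p * N' - 1 - k = p * (N' - c) := by
        rw [Nat.mul_sub, ← hc]; omega
      have h2 : N' - 1 - k / p = N' - c := by omega
      rw [h1, h2]; ring
    · rw [if_neg h, Nat.succ_div_of_not_dvd h]
      have h1 : p * N' - 1 - k = p * N' - (k + 1) := by omega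
      rw [h1]; ring

/-- `#{j ≤ k : p ∤ j} + [k/p] = k`. [cite: Straub2014, Lemma 5.4 (proof: the `[k/p]` indices divisible by `p`)] -/
theorem card_split (p : ℕ) (hp : 0 < p) : ∀ k : ℕ,
    (∑ i ∈ range k, if p ∣ i + 1 then 0 else 1) + k / p = k
  | 0 => by simp [Nat.div_eq_of_lt hp]
  | k + 1 => by
    rw [sum_range_succ]
    by_cases h : p ∣ k + 1
    · rw [if_pos h, Nat.succ_div_of_dvd h]
      have := card_split p hp k; omega
    · rw [if_neg h, Nat.succ_div_of_not_dvd h]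
      have := card_split p hp k; omega

/-- The printed splitting as an exact identity over `ℕ`:
`C(pN' − 1, k) · ∏_{p∤j≤k} j = (∏_{p∤j≤k} (pN' − j)) · C(N' − 1, [k/p])`.
[cite: Straub2014, Lemma 5.4 (proof, displayed identity)] -/
theorem choose_mul_prod_eq (p : ℕ) (hp : 0 < p) (N' k : ℕ) :
    (p * N' - 1).choose k * (∏ i ∈ range k, if p ∣ i + 1 then 1 else (i + 1)) =
      (∏ i ∈ range k, if p ∣ i + 1 then 1 else (p * N' - (i + 1))) * (N' - 1).choose (k / p) := by
  have h1 := descFactorial_split p hp N' k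
  rw [Nat.descFactorial_eq_factorial_mul_choose, Nat.descFactorial_eq_factorial_mul_choose,
    factorial_split p hp k] at h1
  have hpos : 0 < p ^ (k / p) * (k / p).factorial := by positivity
  apply Nat.eq_of_mul_eq_mul_left hpos
  calc p ^ (k / p) * (k / p).factorial * ((p * N' - 1).choose k * ∏ i ∈ range k, if p ∣ i + 1 then 1 else (i + 1))
      = (∏ i ∈ range k, if p ∣ i + 1 then 1 else (i + 1)) * (p ^ (k / p) * (k / p).factorial) *
          (p * N' - 1).choose k := by ring
    _ = (∏ i ∈ range k, if p ∣ i + 1 then 1 else (p * N' - (i + 1))) *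
          (p ^ (k / p) * ((k / p).factorial * (N' - 1).choose (k / p))) := h1
    _ = p ^ (k / p) * (k / p).factorial *
          ((∏ i ∈ range k, if p ∣ i + 1 then 1 else (p * N' - (i + 1))) * (N' - 1).choose (k / p)) := by ring

/-- Lemma 5.4 with the modulus decoupled: for a prime `p`, `N' ≥ 1` and `p^r ∣ pN'`,
`(−1)^k C(pN' − 1, k) ≡ (−1)^{[k/p]} C(N' − 1, [k/p]) (mod p^r)` ("reducing modulo `p^r`": `pN' − j ≡ −j` and
`∏_{p∤j≤k} j` is invertible). [cite: Straub2014, Lemma 5.4 (proof, last step)] -/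
theorem lemma54_core {p : ℕ} (hp : p.Prime) (r : ℕ) {N' : ℕ} (hN'pos : 1 ≤ N') (hdiv : p ^ r ∣ p * N') (k : ℕ) :
    (-1 : ℤ) ^ k * ((p * N' - 1).choose k : ℕ) ≡
      (-1) ^ (k / p) * ((N' - 1).choose (k / p) : ℕ) [ZMOD (p : ℤ) ^ r] := by
  have hp0 : 0 < p := hp.pos
  have hpN'pos : 1 ≤ p * N' := Nat.one_le_iff_ne_zero.mpr (Nat.mul_ne_zero hp0.ne' (by omega))
  -- trivial case `k ≥ pN'`: both binomials vanish
  rcases Nat.lt_or_ge k (p * N') with hk | hk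
  swap
  · have h1 : (p * N' - 1).choose k = 0 := Nat.choose_eq_zero_of_lt (by omega)
    have h2 : (N' - 1).choose (k / p) = 0 := by
      apply Nat.choose_eq_zero_of_lt
      have : N' ≤ k / p := by
        rw [Nat.le_div_iff_mul_le hp0, mul_comm]; exact hk
      omega
    simp [h1, h2]
  -- main case, in `ZMod (p^r)`
  have hmod : ((p : ℤ) ^ r) = ((p ^ r : ℕ) : ℤ) := by push_cast; rfl
  rw [hmod, ← ZMod.intCast_eq_intCast_iff]
  push_cast
  have hpN : ((p * N' : ℕ) : ZMod (p ^ r)) = 0 := by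
    rw [ZMod.natCast_eq_zero_iff]; exact hdiv
  set q := k / p with hq
  set T := ∑ i ∈ range k, (if p ∣ i + 1 then 0 else 1) with hT
  have hkT : T + q = k := card_split p hp0 k
  -- cast of the exact identity
  have hII := congrArg (fun x : ℕ => (x : ZMod (p ^ r))) (choose_mul_prod_eq p hp0 N' k)
  simp only [Nat.cast_mul, Nat.cast_prod] at hII
  -- `∏ (pN' − j) ≡ (−1)^T ∏ j`
  have hQ : (∏ i ∈ range k, ((if p ∣ i + 1 then 1 else (p * N' - (i + 1)) : ℕ) : ZMod (p ^ r))) =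
      (-1 : ZMod (p ^ r)) ^ T * ∏ i ∈ range k, ((if p ∣ i + 1 then 1 else (i + 1) : ℕ) : ZMod (p ^ r)) := by
    rw [hT, ← Finset.prod_pow_eq_pow_sum, ← Finset.prod_mul_distrib]
    apply Finset.prod_congr rfl
    intro i hi
    have hi' : i + 1 ≤ p * N' := by rw [mem_range] at hi; omega
    split_ifs with h
    · simp
    · rw [Nat.cast_sub hi', hpN]
      push_cast
      ring
  -- `∏_{p∤j} j` is a unit mod `p^r`
  have hPu : IsUnit (∏ i ∈ range k, ((if p ∣ i + 1 then 1 else (i + 1) : ℕ) : ZMod (p ^ r))) := by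
    apply Finset.prod_induction _ IsUnit (fun a b ha hb => ha.mul hb) isUnit_one
    intro i _
    split_ifs with h
    · simp
    · have hcop : Nat.Coprime (i + 1) (p ^ r) :=
        Nat.Coprime.pow_right _ (Nat.coprime_comm.mp ((Nat.Prime.coprime_iff_not_dvd hp).mpr h))
      have hu := Units.isUnit (ZMod.unitOfCoprime (i + 1) hcop)
      rwa [ZMod.coe_unitOfCoprime] at hu
  rw [hQ] at hII
  have hII' : (((p * N' - 1).choose k : ℕ) : ZMod (p ^ r)) *
      ∏ i ∈ range k, ((if p ∣ i + 1 then 1 else (i + 1) : ℕ) : ZMod (p ^ r)) =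
      ((-1 : ZMod (p ^ r)) ^ T * (((N' - 1).choose q : ℕ) : ZMod (p ^ r))) *
        ∏ i ∈ range k, ((if p ∣ i + 1 then 1 else (i + 1) : ℕ) : ZMod (p ^ r)) := by
    rw [hII]; ring
  have hC := (IsUnit.mul_left_inj hPu).mp hII'
  rw [hC, ← mul_assoc, ← pow_add]
  congr 1
  rw [show k + T = 2 * T + q by omega, pow_add, pow_mul]
  simp

/-- **Straub 2014, Lemma 5.4 (Beukers 1985), PROVED for `k ≥ 0`, `m ≥ 1`**: for a prime `p` and `r ≥ 1`,
`(−1)^k C(p^r m − 1, k) ≡ (−1)^{[k/p]} C(p^{r−1} m − 1, [k/p]) (mod p^r)`.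
TODO(general form): `k < 0` or `m ≤ 0`, with binomial coefficients extended by (11).
[cite: Straub2014, Lemma 5.4 (43)] [cite: Beukers1985, (the congruence "used in" Beukers 1985, per Straub2014 before Lemma 5.4)] -/
theorem lemma54 {p : ℕ} (hp : p.Prime) {r : ℕ} (hr : 1 ≤ r) {m : ℕ} (hm : 1 ≤ m) (k : ℕ) :
    (-1 : ℤ) ^ k * ((p ^ r * m - 1).choose k : ℕ) ≡
      (-1) ^ (k / p) * ((p ^ (r - 1) * m - 1).choose (k / p) : ℕ) [ZMOD (p : ℤ) ^ r] := by
  have hN : p ^ r * m = p * (p ^ (r - 1) * m) := by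
    rw [← mul_assoc, ← pow_succ']
    congr 2; omega
  rw [hN]
  refine lemma54_core hp r ?_ ⟨m, hN.symm⟩ k
  exact Nat.one_le_iff_ne_zero.mpr (Nat.mul_ne_zero (pow_ne_zero _ hp.ne_zero) (by omega))

end DigitReduction

/-! ### Lemma 5.2: `Σ_{p∤k<p^r} ε^k/k² ≡ 0 (mod p^r)` (PROVED, every `r`, both signs) -/

section PowerSums

/-- Pairing even indices: `Σ_{k<2h+1} (1 + (−1)^k) g(k) = 2 Σ_{j ≤ h} g(2j)`. [folklore] -/
private theorem sum_one_add_neg_one_pow_mul {R : Type*} [CommRing R] (g : ℕ → R) : ∀ h : ℕ,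
    ∑ k ∈ range (2 * h + 1), (1 + (-1 : R) ^ k) * g k = 2 * ∑ j ∈ range (h + 1), g (2 * j)
  | 0 => by simp; ring
  | h + 1 => by
    rw [show 2 * (h + 1) + 1 = 2 * h + 1 + 1 + 1 by ring, sum_range_succ, sum_range_succ,
      sum_one_add_neg_one_pow_mul g h, sum_range_succ (fun j => g (2 * j)) (h + 1)]
    rw [show 2 * h + 1 + 1 = 2 * (h + 1) by ring, pow_succ, pow_mul]
    simp; ring

/-- Reflection: if `g(0) = 0` and `g(2h+1−j) = g(j)` for `1 ≤ j ≤ h`, then `Σ_{k<2h+1} g(k) = 2 Σ_{k ≤ h} g(k)`.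
[folklore] -/
private theorem sum_range_eq_two_mul_half {R : Type*} [CommRing R] (g : ℕ → R) (h : ℕ) (hg0 : g 0 = 0)
    (hrefl : ∀ j, 1 ≤ j → j ≤ h → g (2 * h + 1 - j) = g j) :
    ∑ k ∈ range (2 * h + 1), g k = 2 * ∑ k ∈ range (h + 1), g k := by
  rw [show 2 * h + 1 = (h + 1) + h by ring, Finset.sum_range_add]
  have h2 : ∑ x ∈ range h, g (h + 1 + x) = ∑ k ∈ range (h + 1), g k := by
    rw [← Finset.sum_range_reflect (fun x => g (h + 1 + x)) h]
    rw [Finset.sum_range_succ' g h, hg0, add_zero]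
    apply Finset.sum_congr rfl
    intro i hi
    rw [mem_range] at hi
    have : h + 1 + (h - 1 - i) = 2 * h + 1 - (i + 1) := by omega
    rw [this, hrefl (i + 1) (by omega) (by omega)]
  rw [h2]; ring

variable {p : ℕ} [hp : Fact p.Prime]

/-- `k` prime to `p` is a unit modulo `p^r`. [folklore] -/
private theorem isUnit_natCast_of_not_dvd (r : ℕ) {k : ℕ} (hk : ¬ p ∣ k) :
    IsUnit ((k : ZMod (p ^ r))) := by
  rw [ZMod.isUnit_iff_coprime]
  exact Nat.Coprime.pow_right _ (Nat.coprime_comm.mp ((Nat.Prime.coprime_iff_not_dvd hp.out).mpr hk))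

/-- For `r ≥ 1`, `k` is a unit modulo `p^r` iff `p ∤ k`. [folklore] -/
private theorem isUnit_natCast_iff {r : ℕ} (hr : 1 ≤ r) (k : ℕ) :
    IsUnit ((k : ZMod (p ^ r))) ↔ ¬ p ∣ k := by
  rw [ZMod.isUnit_iff_coprime, Nat.coprime_pow_right_iff (by omega), Nat.coprime_comm,
    Nat.Prime.coprime_iff_not_dvd hp.out]

/-- Inverse of a product of units in `ZMod n`. [folklore] -/
private theorem inv_mul_of_isUnit {n : ℕ} {x y : ZMod n} (hx : IsUnit x) (hy : IsUnit y) :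
    (x * y)⁻¹ = x⁻¹ * y⁻¹ := by
  obtain ⟨u, rfl⟩ := hx
  obtain ⟨v, rfl⟩ := hy
  rw [← Units.val_mul, ZMod.inv_coe_unit, ZMod.inv_coe_unit, ZMod.inv_coe_unit, mul_inv, Units.val_mul]

/-- Inverse of a negated unit in `ZMod n`. [folklore] -/
private theorem inv_neg_of_isUnit {n : ℕ} {x : ZMod n} (hx : IsUnit x) : (-x)⁻¹ = -x⁻¹ := by
  obtain ⟨u, rfl⟩ := hx
  rw [← Units.val_neg, ZMod.inv_coe_unit, ZMod.inv_coe_unit, inv_neg, Units.val_neg]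

/-- A sum over `k < n` of a function of `k mod n` is the sum over `ZMod n`. [folklore] -/
private theorem sum_range_natCast_eq {M : Type*} [AddCommMonoid M] (n : ℕ) [NeZero n] (f : ZMod n → M) :
    ∑ k ∈ range n, f (k : ZMod n) = ∑ x : ZMod n, f x := by
  refine Finset.sum_nbij' (fun k : ℕ => (k : ZMod n)) (fun x : ZMod n => x.val) (fun _ _ => Finset.mem_univ _)
    (fun x _ => Finset.mem_range.mpr (ZMod.val_lt x)) (fun k hk => ?_) (fun x _ => ZMod.natCast_zmod_val x)
    (fun _ _ => rfl)
  exact ZMod.val_natCast_of_lt (Finset.mem_range.mp hk)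

/-- `Σ_{x ∈ (ℤ/p^r)^×} x⁻² = 0` in `ℤ/p^r` for a prime `p ≥ 5`: the printed rescaling argument with `α = 2`
(`Σ_x G(2x) = Σ_x G(x)`, `G(2x) = 2⁻²G(x)`, and `3 = 4 − 1` is a unit). [cite: Straub2014, Lemma 5.2 (proof)] -/
theorem sum_units_inv_sq_eq_zero (h5 : 5 ≤ p) (r : ℕ) :
    ∑ x : ZMod (p ^ r), (if IsUnit x then (x⁻¹) ^ 2 else 0) = 0 := by
  have h2u : IsUnit ((2 : ℕ) : ZMod (p ^ r)) :=
    isUnit_natCast_of_not_dvd r (fun h => by have := Nat.le_of_dvd two_pos h; omega)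
  have h3u : IsUnit ((3 : ℕ) : ZMod (p ^ r)) :=
    isUnit_natCast_of_not_dvd r (fun h => by have := Nat.le_of_dvd (by norm_num) h; omega)
  obtain ⟨two, htwo⟩ := h2u
  set G : ZMod (p ^ r) → ZMod (p ^ r) := fun x => if IsUnit x then (x⁻¹) ^ 2 else 0 with hG
  have hscale : ∀ x, G (↑two * x) = ((↑two⁻¹ : ZMod (p ^ r))) ^ 2 * G x := by
    intro x
    by_cases hx : IsUnit x
    · have h2x : IsUnit ((two : ZMod (p ^ r)) * x) := (Units.isUnit two).mul hx
      simp only [hG, if_pos h2x, if_pos hx]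
      rw [inv_mul_of_isUnit (Units.isUnit two) hx, ZMod.inv_coe_unit]; ring
    · have h2x : ¬ IsUnit ((two : ZMod (p ^ r)) * x) := fun h => hx (isUnit_of_mul_isUnit_right h)
      simp only [hG, if_neg h2x, if_neg hx, mul_zero]
  have hS : ∑ x, G x = ((↑two⁻¹ : ZMod (p ^ r))) ^ 2 * ∑ x, G x := by
    rw [Finset.mul_sum, ← Equiv.sum_comp (Units.mulLeft two) G]
    simp only [Units.mulLeft_apply, hscale]
  change ∑ x, G x = 0
  generalize ∑ x, G x = S at hS
  have hinv : (↑two : ZMod (p ^ r)) * ↑two⁻¹ = 1 := by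
    rw [← Units.val_mul, mul_inv_cancel, Units.val_one]
  have h2 : (↑two : ZMod (p ^ r)) = 2 := by rw [htwo]; push_cast; rfl
  rw [h2] at hinv
  have h3S : (3 : ZMod (p ^ r)) * S = 0 := by
    linear_combination (4 : ZMod (p ^ r)) * hS + S * (2 * (↑two⁻¹ : ZMod (p ^ r)) + 1) * hinv
  have h3 : ((3 : ℕ) : ZMod (p ^ r)) = 3 := by push_cast; rfl
  rw [h3] at h3u
  exact (h3u.mul_right_eq_zero).mp h3S

/-- **Straub 2014, Lemma 5.2, case `ε = 1`, PROVED**: `Σ_{k < p^r, p ∤ k} k⁻² = 0` in `ℤ/p^r` (`p ≥ 5`, every `r ≥ 0`).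
[cite: Straub2014, Lemma 5.2 (36), ε = 1] -/
theorem sum_range_inv_sq_eq_zero (h5 : 5 ≤ p) (r : ℕ) :
    ∑ k ∈ range (p ^ r), (if p ∣ k then 0 else ((k : ZMod (p ^ r))⁻¹) ^ 2) = 0 := by
  haveI : NeZero (p ^ r) := ⟨pow_ne_zero _ hp.out.ne_zero⟩
  rcases Nat.eq_zero_or_pos r with hr | hr
  · subst hr
    simp
  have hcongr : ∑ k ∈ range (p ^ r), (if p ∣ k then (0 : ZMod (p ^ r)) else ((k : ZMod (p ^ r))⁻¹) ^ 2) =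
      ∑ k ∈ range (p ^ r), (fun x : ZMod (p ^ r) => if IsUnit x then (x⁻¹) ^ 2 else 0) (k : ZMod (p ^ r)) := by
    apply Finset.sum_congr rfl
    intro k _
    simp only [isUnit_natCast_iff hr]
    by_cases h : p ∣ k <;> simp [h]
  rw [hcongr, sum_range_natCast_eq (p ^ r) (fun x : ZMod (p ^ r) => if IsUnit x then (x⁻¹) ^ 2 else 0)]
  exact sum_units_inv_sq_eq_zero h5 r

/-- **Straub 2014, Lemma 5.2, case `ε = −1`, PROVED**: `Σ_{k < p^r, p ∤ k} (−1)^k k⁻² = 0` in `ℤ/p^r` (`p ≥ 5`,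
every `r ≥ 0`); by reflection `k ↦ p^r − k` and doubling `k ↦ 2k` (see the module docstring: the printed rescaling
does not apply verbatim to `ε = −1`). [cite: Straub2014, Lemma 5.2 (36), ε = −1] -/
theorem sum_range_neg_one_pow_mul_inv_sq_eq_zero (h5 : 5 ≤ p) (r : ℕ) :
    ∑ k ∈ range (p ^ r), (-1 : ZMod (p ^ r)) ^ k * (if p ∣ k then 0 else ((k : ZMod (p ^ r))⁻¹) ^ 2) = 0 := by
  haveI : NeZero (p ^ r) := ⟨pow_ne_zero _ hp.out.ne_zero⟩
  rcases Nat.eq_zero_or_pos r with hr | hr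
  · subst hr
    norm_num
  have hp2 : p ≠ 2 := by omega
  have hodd : Odd (p ^ r) := (hp.out.odd_of_ne_two hp2).pow
  obtain ⟨h, hh⟩ := hodd
  have hrange : range (p ^ r) = range (2 * h + 1) := by rw [hh]
  set g : ℕ → ZMod (p ^ r) := fun k => if p ∣ k then 0 else ((k : ZMod (p ^ r))⁻¹) ^ 2 with hg
  have hSplus : ∑ k ∈ range (p ^ r), g k = 0 := sum_range_inv_sq_eq_zero h5 r
  -- two is a unit, `t = 2⁻¹`
  have h2u : IsUnit ((2 : ℕ) : ZMod (p ^ r)) :=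
    isUnit_natCast_of_not_dvd r (fun h => by have := Nat.le_of_dvd two_pos h; omega)
  -- (i) reflection: S⁺ = 2H
  have hg0 : g 0 = 0 := by simp [hg]
  have hrefl : ∀ j, 1 ≤ j → j ≤ h → g (2 * h + 1 - j) = g j := by
    intro j hj1 hjh
    have hjle : j ≤ 2 * h + 1 := by omega
    have hdvd : p ∣ (2 * h + 1 - j) ↔ p ∣ j := by
      have hpn : p ∣ 2 * h + 1 := by rw [← hh]; exact dvd_pow_self p hr.ne'
      constructor
      · intro hd
        have := Nat.dvd_sub hpn hd
        rwa [Nat.sub_sub_self hjle] at this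
      · intro hd; exact Nat.dvd_sub hpn hd
    simp only [hg, hdvd]
    by_cases hpj : p ∣ j
    · simp [hpj]
    · rw [if_neg hpj, if_neg hpj, Nat.cast_sub hjle]
      have : ((2 * h + 1 : ℕ) : ZMod (p ^ r)) = 0 := by rw [← hh, ZMod.natCast_self]
      rw [this, zero_sub, inv_neg_of_isUnit (isUnit_natCast_of_not_dvd r hpj), neg_sq]
  have hhalf : ∑ k ∈ range (2 * h + 1), g k = 2 * ∑ k ∈ range (h + 1), g k :=
    sum_range_eq_two_mul_half g h hg0 hrefl
  -- (ii) H = 0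
  have hH : ∑ k ∈ range (h + 1), g k = 0 := by
    have h2 : ((2 : ℕ) : ZMod (p ^ r)) = 2 := by push_cast; rfl
    rw [h2] at h2u
    apply (h2u.mul_right_eq_zero).mp
    rw [← hhalf, ← hrange]; exact hSplus
  -- (iii) doubling: g(2j) = t² g(j)
  have hdouble : ∀ j, g (2 * j) = (((2 : ℕ) : ZMod (p ^ r))⁻¹) ^ 2 * g j := by
    intro j
    by_cases hpj : p ∣ j
    · have : p ∣ 2 * j := Dvd.dvd.mul_left hpj 2
      simp [hg, hpj, this]
    · have h2j : ¬ p ∣ 2 * j := by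
        intro hd
        rcases (Nat.Prime.dvd_mul hp.out).mp hd with h2 | h2
        · have := Nat.le_of_dvd two_pos h2; omega
        · exact hpj h2
      simp only [hg, if_neg hpj, if_neg h2j]
      rw [Nat.cast_mul, inv_mul_of_isUnit h2u (isUnit_natCast_of_not_dvd r hpj)]; ring
  -- (iv) pairing: A + S⁺ = 2E = 2t²H = 0
  have hpair := sum_one_add_neg_one_pow_mul g h
  have hE : ∑ j ∈ range (h + 1), g (2 * j) = 0 := by
    rw [Finset.sum_congr rfl (fun j _ => hdouble j), ← Finset.mul_sum, hH, mul_zero]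
  rw [hE, mul_zero] at hpair
  rw [hrange]
  rw [hrange] at hSplus
  have : ∑ k ∈ range (2 * h + 1), (-1 : ZMod (p ^ r)) ^ k * g k =
      ∑ k ∈ range (2 * h + 1), (1 + (-1 : ZMod (p ^ r)) ^ k) * g k - ∑ k ∈ range (2 * h + 1), g k := by
    rw [← Finset.sum_sub_distrib]
    apply Finset.sum_congr rfl
    intro k _
    ring
  rw [this, hpair, hSplus, sub_zero]

/-- **Straub 2014, Lemma 5.2, PROVED** (as printed, both signs): for a prime `p ≥ 5`, `ε ∈ {−1, 1}` and every
`r ≥ 0`, `Σ_{k=1, p∤k}^{p^r−1} ε^k/k² ≡ 0 (mod p^r)`, read in `ℤ/p^r` with `1/k` the inverse of the unit `k`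
(the `r = 1`, `ε = 1` case is the tree's `AperySupercongruences.sum_Ico_inv_sq_eq_zero`). [cite: Straub2014, Lemma 5.2 (36)] -/
theorem lemma52 (h5 : 5 ≤ p) (r : ℕ) (ε : ℤ) (hε : ε = 1 ∨ ε = -1) :
    ∑ k ∈ (range (p ^ r)).filter (fun k => ¬ p ∣ k), (ε : ZMod (p ^ r)) ^ k * ((k : ZMod (p ^ r))⁻¹) ^ 2 = 0 := by
  rw [Finset.sum_filter]
  rcases hε with rfl | rfl
  · refine Eq.trans (Finset.sum_congr rfl fun k _ => ?_) (sum_range_inv_sq_eq_zero (p := p) h5 r)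
    by_cases h : p ∣ k <;> simp [h]
  · refine Eq.trans (Finset.sum_congr rfl fun k _ => ?_) (sum_range_neg_one_pow_mul_inv_sq_eq_zero (p := p) h5 r)
    by_cases h : p ∣ k <;> simp [h]

end PowerSums

end Literature.Combinatorics.Enumerative.MultivariateAperyNumbers
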